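import Mathlib.GroupTheory.SpecificGroups.Alternating.Simple
import Mathlib.GroupTheory.GroupAction.Quotient
import Mathlib.GroupTheory.Index
import Mathlib.Data.Finite.Perm
import Mathlib.Data.Set.Card
import HarnessLib

/-!
# Subgroups of small index in the alternating group (Jordan's bound)

Topic `Literature/GroupTheory/PermutationGroups`.  Fully PROVED (no named facts).  Companion to
`SmallIndexSubgroups.lean` (Dixon–Mortimer, *Permutation Groups*, Thm 5.2B, for subgroups of
`Sym`): the alternating-group, `k = 1` end of the same circle of results.

**Theorem** (classical; the case `r = 1` of Dixon–Mortimer 1996, Thm 5.2A, and the standard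
corollary of the simplicity of `A_n` printed in Rotman 1995 as Thm 3.11 + Thm 3.14/Cor 3.15 and
Exercise 3.25): *if `|β| ≥ 5`, the alternating group `Alt(β)` has no proper subgroup of index
less than `|β|`* (`alternatingGroup_subgroup_eq_top_of_index_lt_card`).

Proof (Rotman, Thm 3.14 "representation on cosets" and Cor 3.15 "a simple group which contains a
subgroup `H` of index `n` can be imbedded in `S_n`", with Thm 3.11 "`A_n` is simple for all
`n ≥ 5`"): the kernel of the action of `A := Alt(β)` on the cosets `A ⧸ H` is the normal core of
`H` (Mathlib `Subgroup.normalCore_eq_ker`); by simplicity (Mathlib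
`alternatingGroup.normal_subgroup_eq_bot_or_eq_top`) it is `⊤` — then `H = ⊤` — or `⊥` — then
`A` embeds in `Sym(A ⧸ H)`, so `|β|!/2 = |A| ≤ [A : H]! ≤ (|β| - 1)!`, i.e. `|β| ≤ 2`, absurd.

Consequences proved here, in the forms consumed by symmetric-circuit arguments (route
`Summits/ValiantsHypothesis/…/Theses/MonotoneRestoration.lean`, crux `MonotoneRestorationQP`, stub
`stub_altFixing_orbit_dichotomy`; and the `PneNP` symmetry-budget lines that already use Thm 5.2B):
* `alternatingGroup_smul_eq_self_of_orbit_subset` — ORBIT FORM: in any `Alt(β)`-set (`|β| ≥ 5`) an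
  orbit with fewer than `|β|` elements is a fixed point (orbit–stabiliser,
  `MulAction.index_stabilizer`).
* the POINTWISE-STABILISER transport `Alt(α)_(X) = Alt(α ∖ X)`: an even permutation of the
  complement of a finite set `X`, extended by the identity, is even and fixes `X` pointwise
  (`ofSubtype_alternatingGroup_apply_of_mem`, `sign_ofSubtype_alternatingGroup`), and every even
  permutation fixing `X` pointwise arises this way (`exists_alternatingGroup_ofSubtype_eq`);
* `alternating_fixing_smul_eq_self_of_orbit_subset` — the orbit form for the group
  `Alt(α)_(X) = {ρ ∈ Sym(α) : ρ|_X = id, sgn ρ = 1}` acting through any action of `Sym(α)`: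
  if `|α| - |X| ≥ 5` and the `Alt(α)_(X)`-orbit of a point `q` lies in a finite set with fewer
  than `|α| - |X|` elements, then `Alt(α)_(X)` fixes `q`.  (Sharp: the orbit of the variable
  `x_{aa}` under the diagonal action on `K[x_{ab}]` has exactly `|α| - |X|` elements; and `|β| ≥ 5`
  cannot be lowered to `4`, `V₄ ◁ A₄` having index `3`.)

`lean search` (2026-08-17): no statement of this shape in Mathlib or the tree
(`eq_top_of_index_lt`, `index_lt_card` over `alternatingGroup`: none); Mathlib provides the
simplicity of `alternatingGroup` (`alternatingGroup.isSimpleGroup`, all `|α| ≥ 5`) and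
`two_mul_nat_card_alternatingGroup`, which this file combines.

## References

* [Rotman1995] J. J. Rotman, *An Introduction to the Theory of Groups*, 4th ed., GTM 148,
  Springer 1995, Ch. 3: Thm 3.11 (`A_n` simple, `n ≥ 5`), Thm 3.14 and Cor 3.15 (representation
  on cosets; a simple group with a subgroup of index `n` embeds in `S_n`), Exercise 3.25.
* [DixonMortimer1996] J. D. Dixon, B. Mortimer, *Permutation Groups*, GTM 163, Springer 1996,
  §5.2, Thm 5.2A (subgroups of index `< C(n, r)` in `Alt(n)`; the case `r = 1`).
-/

namespace Literature.GroupTheory.PermutationGroups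

open Equiv Equiv.Perm MulAction Subgroup

/-! ### Jordan's bound: no proper subgroup of `Alt(β)` has index `< |β|` -/

section IndexBound

variable {β : Type*} [Fintype β] [DecidableEq β]

/-- **Subgroups of small index in the alternating group** (the case `r = 1` of Dixon–Mortimer
Thm 5.2A; Rotman 1995, Cor 3.15 with Thm 3.11): if `|β| ≥ 5`, every subgroup of `Alt(β)` of index
less than `|β|` is `Alt(β)` itself.  Proof: the normal core of `H` is the kernel of the action on
`Alt(β) ⧸ H`; by simplicity it is `⊤` (and then `H = ⊤`) or trivial, in which case
`|β|!/2 = |Alt(β)| ≤ [Alt(β) : H]! ≤ (|β| - 1)!`, impossible for `|β| ≥ 3`.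
[cite: Rotman1995, Thm 3.11, Thm 3.14, Cor 3.15; DixonMortimer1996, Thm 5.2A (r = 1)] -/
theorem alternatingGroup_subgroup_eq_top_of_index_lt_card (h5 : 5 ≤ Fintype.card β)
    (H : Subgroup (alternatingGroup β)) (hH : H.index < Fintype.card β) : H = ⊤ := by
  classical
  have h5' : 5 ≤ Nat.card β := by rwa [Nat.card_eq_fintype_card]
  haveI : Nontrivial β := Fintype.one_lt_card_iff_nontrivial.1 (by omega)
  rcases alternatingGroup.normal_subgroup_eq_bot_or_eq_top h5' (N := H.normalCore) with hbot | htop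
  · -- trivial normal core: `Alt(β)` embeds in `Sym(Alt(β) ⧸ H)`
    exfalso
    have hinj : Function.Injective
        (MulAction.toPermHom (alternatingGroup β) (alternatingGroup β ⧸ H)) := by
      rw [← MonoidHom.ker_eq_bot_iff, ← Subgroup.normalCore_eq_ker]
      exact hbot
    have h1 : Nat.card (alternatingGroup β) ≤ (H.index).factorial := by
      have := Nat.card_le_card_of_injective _ hinj
      rwa [Nat.card_perm] at this
    have h2 : 2 * Nat.card (alternatingGroup β) = (Nat.card β).factorial := by
      rw [two_mul_nat_card_alternatingGroup (α := β), Nat.card_perm]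
    have h3 : (H.index).factorial ≤ (Nat.card β - 1).factorial :=
      Nat.factorial_le (by rw [Nat.card_eq_fintype_card]; omega)
    have h4 : (Nat.card β).factorial = Nat.card β * (Nat.card β - 1).factorial := by
      conv_lhs => rw [show Nat.card β = (Nat.card β - 1) + 1 by omega, Nat.factorial_succ]
      congr 1
      omega
    have hpos : 0 < (Nat.card β - 1).factorial := Nat.factorial_pos _
    have h6 : Nat.card β * (Nat.card β - 1).factorial ≤ 2 * (Nat.card β - 1).factorial := by
      rw [← h4, ← h2]
      exact Nat.mul_le_mul_left 2 (h1.trans h3)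
    have h7 : Nat.card β ≤ 2 := Nat.le_of_mul_le_mul_right h6 hpos
    omega
  · rw [eq_top_iff, ← htop]
    exact Subgroup.normalCore_le H

/-- **Orbit form.** In an `Alt(β)`-set with `|β| ≥ 5`, a point whose orbit is contained in a
finite set with fewer than `|β|` elements is fixed by `Alt(β)`: the stabiliser has index equal to
the size of the orbit (`MulAction.index_stabilizer`), hence `< |β|`, hence is everything.
[cite: Rotman1995, Cor 3.15 with Thm 3.11; DixonMortimer1996, Thm 5.2A (r = 1)] -/
theorem alternatingGroup_smul_eq_self_of_orbit_subset {γ : Type*}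
    [MulAction (alternatingGroup β) γ] (h5 : 5 ≤ Fintype.card β) (q : γ) (T : Finset γ)
    (hT : T.card < Fintype.card β) (horb : ∀ g : alternatingGroup β, g • q ∈ T) :
    ∀ g : alternatingGroup β, g • q = q := by
  have hsub : MulAction.orbit (alternatingGroup β) q ⊆ (T : Set γ) := by
    rintro _ ⟨g, rfl⟩
    exact horb g
  have hidx : (MulAction.stabilizer (alternatingGroup β) q).index < Fintype.card β := by
    rw [MulAction.index_stabilizer]
    refine (Set.ncard_le_ncard hsub (Finset.finite_toSet T)).trans_lt ?_
    rwa [Set.ncard_coe_finset]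
  have htop := alternatingGroup_subgroup_eq_top_of_index_lt_card h5 _ hidx
  intro g
  have hg : g ∈ MulAction.stabilizer (alternatingGroup β) q := by
    rw [htop]; exact Subgroup.mem_top g
  exact MulAction.mem_stabilizer_iff.1 hg

end IndexBound

/-! ### The pointwise stabiliser `Alt(α)_(X)` as the alternating group of the complement -/

section Fixing

variable {α : Type*} [Fintype α] [DecidableEq α]

/-- An even permutation of the complement of `X`, extended by the identity (`Perm.ofSubtype`),
fixes every point of `X`. [folklore] -/
theorem ofSubtype_alternatingGroup_apply_of_mem (X : Finset α)
    (g : alternatingGroup {x : α // x ∉ X}) {x : α} (hx : x ∈ X) :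
    Perm.ofSubtype (g : Perm {x : α // x ∉ X}) x = x :=
  Perm.ofSubtype_apply_of_not_mem _ (not_not.2 hx)

/-- An even permutation of the complement of `X`, extended by the identity, is even
(`Perm.sign_ofSubtype`). [folklore] -/
theorem sign_ofSubtype_alternatingGroup (X : Finset α) (g : alternatingGroup {x : α // x ∉ X}) :
    Perm.sign (Perm.ofSubtype (g : Perm {x : α // x ∉ X})) = 1 := by
  rw [Perm.sign_ofSubtype]
  exact Perm.mem_alternatingGroup.1 g.2

/-- Conversely, every even permutation of `α` fixing `X` pointwise is the extension by the
identity of an even permutation of the complement of `X` (its restriction `Perm.subtypePerm`;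
`Perm.sign_subtypePerm`, `Perm.ofSubtype_subtypePerm`).  Together with the two previous lemmas:
`Alt(α)_(X) = Alt(α ∖ X)` under `Perm.ofSubtype`. [folklore] -/
theorem exists_alternatingGroup_ofSubtype_eq (X : Finset α) (ρ : Perm α)
    (hρ : ∀ x ∈ X, ρ x = x) (hsign : Perm.sign ρ = 1) :
    ∃ g : alternatingGroup {x : α // x ∉ X}, Perm.ofSubtype (g : Perm {x : α // x ∉ X}) = ρ := by
  have hρp : ∀ x, ρ x ∉ X ↔ x ∉ X := by
    intro x
    by_cases hx : x ∈ X
    · rw [hρ x hx]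
    · refine ⟨fun _ => hx, fun _ hρx => ?_⟩
      -- `ρ` fixes `X` pointwise, so `ρ x ∈ X` gives `ρ (ρ x) = ρ x`, i.e. `ρ x = x ∈ X`
      have h1 : ρ (ρ x) = ρ x := hρ _ hρx
      exact hx (ρ.injective h1 ▸ hρx)
  have h2 : ∀ x, ρ x ≠ x → x ∉ X := fun x hx hxX => hx (hρ x hxX)
  have hmem : ρ.subtypePerm hρp ∈ alternatingGroup {x : α // x ∉ X} := by
    rw [Perm.mem_alternatingGroup]
    have := Perm.sign_subtypePerm ρ hρp h2
    rw [hsign] at this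
    convert this using 2
  exact ⟨⟨ρ.subtypePerm hρp, hmem⟩, Perm.ofSubtype_subtypePerm hρp h2⟩

/-- **Orbit form for the pointwise alternating stabiliser.** Let `Sym(α)` act on `γ`, let
`X ⊆ α` with `|α| - |X| ≥ 5`, and let `q ∈ γ`.  If the orbit of `q` under
`Alt(α)_(X) = {ρ : ρ|_X = id, sgn ρ = 1}` is contained in a finite set `T` with
`|T| < |α| - |X|`, then every element of `Alt(α)_(X)` fixes `q`.  (Transport to
`Alt(α ∖ X)` by `Perm.ofSubtype` and `alternatingGroup_smul_eq_self_of_orbit_subset`.)  This is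
the group-theoretic content of stub `stub_altFixing_orbit_dichotomy` of crux
`MonotoneRestorationQP` (route MonotoneRestoration of summit ValiantsHypothesis), where `γ` is a
polynomial ring with the diagonal relabelling action.
[cite: Rotman1995, Cor 3.15 with Thm 3.11; DixonMortimer1996, Thm 5.2A (r = 1)] -/
theorem alternating_fixing_smul_eq_self_of_orbit_subset {γ : Type*} [MulAction (Perm α) γ]
    (X : Finset α) (h5 : X.card + 5 ≤ Fintype.card α) (q : γ) (T : Finset γ)
    (hT : T.card + X.card < Fintype.card α)
    (horb : ∀ ρ : Perm α, (∀ x ∈ X, ρ x = x) → Perm.sign ρ = 1 → ρ • q ∈ T) :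
    ∀ ρ : Perm α, (∀ x ∈ X, ρ x = x) → Perm.sign ρ = 1 → ρ • q = q := by
  classical
  -- the alternating group of the free points acts through `ofSubtype`
  let A := alternatingGroup {x : α // x ∉ X}
  letI : MulAction A γ :=
    MulAction.compHom γ ((Perm.ofSubtype : Perm {x : α // x ∉ X} →* Perm α).comp A.subtype)
  have hsmul : ∀ g : A, g • q = (Perm.ofSubtype (g : Perm {x : α // x ∉ X})) • q := fun _ => rfl
  have hcard : Fintype.card {x : α // x ∉ X} = Fintype.card α - X.card := by
    rw [Fintype.card_subtype_compl, Fintype.card_coe]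
  have h5' : 5 ≤ Fintype.card {x : α // x ∉ X} := by rw [hcard]; omega
  have hT' : T.card < Fintype.card {x : α // x ∉ X} := by rw [hcard]; omega
  have horb' : ∀ g : A, g • q ∈ T := fun g => by
    rw [hsmul]
    exact horb _ (fun x hx => ofSubtype_alternatingGroup_apply_of_mem X g hx)
      (sign_ofSubtype_alternatingGroup X g)
  have hfix := alternatingGroup_smul_eq_self_of_orbit_subset h5' q T hT' horb'
  intro ρ hρ hsign
  obtain ⟨g, hg⟩ := exists_alternatingGroup_ofSubtype_eq X ρ hρ hsign
  have := hfix g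
  rwa [hsmul, hg] at this

end Fixing

end Literature.GroupTheory.PermutationGroups
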